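import Summits.CriticalPhenomena.PercolationContinuityZ3.Theorems.PercNearOneGluingAdditiveGluingMultiEdgeLemma3Delta
import Summits.CriticalPhenomena.PercolationContinuityZ3.Theorems.PercNearOneGluingAdditiveGluingOneBond
import Literature.Probability.Percolation.KozmaNitzanPreFKG
import HarnessLib

/-!
# `NoHeavyLowerTail` (stmt-CriticalPhenomena-4575) — the SWITCHING LEMMA and the two-edge
# SEQUENTIAL form of Kozma–Nitzan's Lemma 3(i) ("first-open-edge domination")

Support file (hull-port / coupling seat `prim-hp-1` gen 8; `--supports stmt-CriticalPhenomena-4575`).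
No definitions, no named facts, no sorries.

Setting: `μ = prodBernoulli w` on the bond configurations of `Fin n`, a target vertex `b`; write
`τ(y) = μ(y ↔ b)` and, for an event `E`, `μ(y; E) = μ({y ↔ b} ∩ E)`.

* `monotone_contract` — Kozma–Nitzan's Lemma 5 in gluing form for ONE pair `e = s(v,u)`: if
  `τ_{w[e↦0]}(c) ≤ τ_{w[e↦0]}(v)` then `τ_{w[e↦1]}(c) ≤ τ_{w[e↦1]}(v)` (a third vertex that is behind `v`
  when the pair is deleted stays behind the contracted pair). [tree `starGlue_lemma5_delta`]
* `switching` — the **switching lemma** (new): for a pair `e = s(v₁,u)`, ANY vertex `v₂`, and a vertex `a`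
  with `τ(a) ≤ τ(v₁) + δ₁`, `τ(a) ≤ τ(v₂) + δ₂` (any real `δ₁, δ₂`):
  `τ(a) ≤ μ(v₁; e open) + μ(v₂; e closed) + max δ₁ δ₂`
  ("`a` is dominated by the random anchor: `v₁` if `e` is open, `v₂` if `e` is closed").  Proof: if
  `μ(v₂; e open) ≤ μ(v₁; e open)` use the second hypothesis; otherwise `monotone_contract` forces
  `μ(v₂; e closed) > μ(v₁; e closed)` and the first hypothesis finishes.  `v₂ = a` is Lemma 3(i) for the
  event `{e open}`; `v₂ = v₁` is the hypothesis.
* `lemma3i_pair` — Lemma 3(i) with slack for the increasing event `{e open}`, `e ∋ v`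
  [tree `KozmaNitzan2024_lemma3_i`].
* `seq_two` — the **two-edge sequential Lemma 3(i)** (new): pairs `e₁ = s(v₁,u₁)`, `e₂ = s(v₂,u₂)`,
  `τ(a) ≤ τ(v_i) + δ_i` (`i = 1,2`):
  `μ(a; e₁ ∨ e₂ open) ≤ μ(v₁; e₁ open) + μ(v₂; e₁ closed, e₂ open) + max δ₁ δ₂`,
  i.e. `a` is dominated by the anchor of the FIRST open pair.  Proof: Lemma 3(i) for `e₁`; Lemma 3(i) for
  `e₂` in the graph `w[e₁ ↦ 0]`, whose domination gap `[μ(a; e₁ closed) − μ(v₂; e₁ closed)]⁺` is at most the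
  slack of the first step plus `max δ₁ δ₂` — this is exactly `switching`.  (The termwise statement
  "`a ≤ v₂` given `e₁` closed" is false in general; the slack of the first pair pays for it.)

Why (memo HULLPORT-COUPLING.md §50): with `w` the unglued depth-two graph (`split`) and `e₁, e₂` the two
"dangerous" port pairs of a hub block, `seq_two` for the two orders is the covering inequality that
produces a common anchor parameter for the two up-set certificates (`UpsetExchange.upsetExchange_any`),
closing Kozma–Nitzan's Question 9 for depth-two observers with at most two dangerous ports
(`…NoHeavyLowerTailBlockQ9TwoDangerous.lean`).  The `k`-edge version holds by the same induction
(error `max_i δ_i`); only `k = 2` is needed there.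
-/

namespace Summit.CriticalPhenomena.PercolationContinuityZ3.Theorems

open MeasureTheory Set
open Literature.Probability.LatticeModels
open Literature.Probability.Percolation

noncomputable section
open Classical

namespace SeqExchange

variable {n : ℕ}

/-- For a non-loop pair `e = s(v,u)`, `e` lies in the open edge cluster of its endpoint `v` iff `e` is
open. [folklore] -/
theorem mk_mem_openEdgeCluster_iff (ω : BondConfig (Fin n)) {v u : Fin n} (hvu : v ≠ u) :
    s(v, u) ∈ openEdgeCluster ω v ↔ s(v, u) ∈ ω := by
  rw [mem_openEdgeCluster_iff]
  constructor
  · exact fun h => h.1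
  · intro he
    refine ⟨he, by rw [Sym2.mk_isDiag_iff]; exact hvu, fun y hy => ?_⟩
    rcases Sym2.mem_iff.1 hy with rfl | rfl
    · exact SimpleGraph.Reachable.refl _
    · exact ((openGraph_adj ω v y).2 ⟨he, hvu⟩).reachable

/-- The event "`s(v,u)` is open" written as an upper-set condition on the open edge cluster of `v`.
[folklore] -/
theorem setOf_mk_mem_eq (v u : Fin n) (hvu : v ≠ u) :
    {ω : BondConfig (Fin n) | s(v, u) ∈ ω} =
      {ω : BondConfig (Fin n) | openEdgeCluster ω v ∈ {C : Set (Sym2 (Fin n)) | s(v, u) ∈ C}} := by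
  ext ω
  simp only [mem_setOf_eq]
  exact (mk_mem_openEdgeCluster_iff ω hvu).symm

/-- **Lemma 3(i) for one pair, with slack.**  If `e = s(v,u)` is a non-loop pair and
`μ(a ↔ b) ≤ μ(v ↔ b) + δ` (`δ ≥ 0`), then `μ(a ↔ b, e open) ≤ μ(v ↔ b, e open) + δ·μ(e open)`.
[cite: KozmaNitzan2024, Lemma 3(i) (pp. 6–7) — tree `KozmaNitzan2024_lemma3_i` with `Q = {e open}`] -/
theorem lemma3i_pair (w : Sym2 (Fin n) → unitInterval) (a v u b : Fin n) (hvu : v ≠ u)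
    {δ : ℝ} (hδ : 0 ≤ δ)
    (h : (prodBernoulli w).real (openConn a b) ≤ (prodBernoulli w).real (openConn v b) + δ) :
    (prodBernoulli w).real (openConn a b ∩ {ω | s(v, u) ∈ ω}) ≤
      (prodBernoulli w).real (openConn v b ∩ {ω | s(v, u) ∈ ω}) +
        δ * (prodBernoulli w).real {ω : BondConfig (Fin n) | s(v, u) ∈ ω} := by
  have hup : IsUpperSet {C : Set (Sym2 (Fin n)) | s(v, u) ∈ C} := fun C C' hle hC => hle hC
  have key := KozmaNitzan2024_lemma3_i w a v b hδ h hup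
  rw [← setOf_mk_mem_eq v u hvu] at key
  exact key

/-- The event `{e open}` has probability `w e`. [folklore] -/
theorem real_setOf_mem (w : Sym2 (Fin n) → unitInterval) (e : Sym2 (Fin n)) :
    (prodBernoulli w).real {ω : BondConfig (Fin n) | e ∈ ω} = (w e : ℝ) := by
  have h := goodStepEI_real_inter_open_eq w e (Set.univ : Set (BondConfig (Fin n)))
  rw [Set.univ_inter] at h
  rw [h, probReal_univ, mul_one]

/-- The event `{e closed}` has probability `1 − w e`. [folklore] -/
theorem real_setOf_notMem (w : Sym2 (Fin n) → unitInterval) (e : Sym2 (Fin n)) :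
    (prodBernoulli w).real {ω : BondConfig (Fin n) | e ∉ ω} = 1 - (w e : ℝ) := by
  have h := goodStepEI_real_inter_closed_eq w e (Set.univ : Set (BondConfig (Fin n)))
  rw [Set.univ_inter] at h
  rw [h, probReal_univ, mul_one]

/-- Splitting an event along the state of one pair. [folklore] -/
theorem real_eq_inter_mem_add_inter_notMem (w : Sym2 (Fin n) → unitInterval) (e : Sym2 (Fin n))
    (S : Set (BondConfig (Fin n))) :
    (prodBernoulli w).real S =
      (prodBernoulli w).real (S ∩ {ω | e ∈ ω}) + (prodBernoulli w).real (S ∩ {ω | e ∉ ω}) := by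
  rw [goodStepEI_real_inter_open_eq, goodStepEI_real_inter_closed_eq, stub_oneBondDecomp_k15 n w e S]
  ring

/-- **Monotonicity under contraction** (Kozma–Nitzan's Lemma 5 in gluing form for one pair): for a
non-loop pair `e = s(v,u)` and any vertex `c`, if `c` is at most as connected to `b` as `v` when `e` is
deleted, then `c` is at most as connected to `b` as `v` (equivalently, as the contracted pair) when `e` is
contracted. [cite: KozmaNitzan2024, Lemma 5 (p. 13) — tree `starGlue_lemma5_delta`] -/
theorem monotone_contract (w : Sym2 (Fin n) → unitInterval) (c v u b : Fin n) (hvu : v ≠ u)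
    (h : (prodBernoulli (Function.update w s(v, u) 0)).real (openConn c b) ≤
      (prodBernoulli (Function.update w s(v, u) 0)).real (openConn v b)) :
    (prodBernoulli (Function.update w s(v, u) 1)).real (openConn c b) ≤
      (prodBernoulli (Function.update w s(v, u) 1)).real (openConn v b) := by
  set w₀ : Sym2 (Fin n) → unitInterval := Function.update w s(v, u) 0 with hw₀
  have hD : ∀ e ∈ ({s(u, v)} : Finset (Sym2 (Fin n))), ∃ a, a ≠ u ∧ e = s(u, a) := by
    intro e he
    rw [Finset.mem_singleton] at he
    exact ⟨v, hvu, he⟩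
  have hv : s(u, v) ∈ ({s(u, v)} : Finset (Sym2 (Fin n))) := Finset.mem_singleton_self _
  have key := starGlue_lemma5_delta w₀ u {s(u, v)} hD c v b hv hvu le_rfl (by simpa using h)
  have hfun : (fun e : Sym2 (Fin n) => if e ∈ ({s(u, v)} : Finset (Sym2 (Fin n))) then (1 : unitInterval)
      else w₀ e) = Function.update w s(v, u) 1 := by
    funext e
    by_cases he : e = s(v, u)
    · subst he
      rw [if_pos (by rw [Finset.mem_singleton, Sym2.eq_swap]), Function.update_self]
    · rw [if_neg (by rw [Finset.mem_singleton, Sym2.eq_swap]; exact he), Function.update_of_ne he,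
        hw₀, Function.update_of_ne he]
  rw [hfun] at key
  simpa using key

/-- **The switching lemma.**  For a non-loop pair `e = s(v₁,u)`, any vertex `v₂`, and a vertex `a` with
`μ(a ↔ b) ≤ μ(v₁ ↔ b) + δ₁` and `μ(a ↔ b) ≤ μ(v₂ ↔ b) + δ₂` (any real slacks):
`μ(a ↔ b) ≤ μ(v₁ ↔ b, e open) + μ(v₂ ↔ b, e closed) + max δ₁ δ₂`.
Equivalently `μ(a ↔ b, e closed) − μ(v₂ ↔ b, e closed) ≤ [μ(v₁ ↔ b, e open) − μ(a ↔ b, e open)] + max δ₁ δ₂`: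
the domination defect of `a` against `v₂` after deleting `e` is paid by the slack of Lemma 3(i) for `e`.
[cite: KozmaNitzan2024, Lemma 5 (p. 13); this work (memo HULLPORT-COUPLING.md §50(b))] -/
theorem switching (w : Sym2 (Fin n) → unitInterval) (a v₁ u v₂ b : Fin n) (hvu : v₁ ≠ u)
    {δ₁ δ₂ : ℝ}
    (h₁ : (prodBernoulli w).real (openConn a b) ≤ (prodBernoulli w).real (openConn v₁ b) + δ₁)
    (h₂ : (prodBernoulli w).real (openConn a b) ≤ (prodBernoulli w).real (openConn v₂ b) + δ₂) :
    (prodBernoulli w).real (openConn a b) ≤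
      (prodBernoulli w).real (openConn v₁ b ∩ {ω | s(v₁, u) ∈ ω}) +
        (prodBernoulli w).real (openConn v₂ b ∩ {ω | s(v₁, u) ∉ ω}) + max δ₁ δ₂ := by
  set μ := prodBernoulli w with hμ
  set e : Sym2 (Fin n) := s(v₁, u) with he
  have hsplit₁ := real_eq_inter_mem_add_inter_notMem w e (openConn v₁ b)
  have hsplit₂ := real_eq_inter_mem_add_inter_notMem w e (openConn v₂ b)
  have hm₁ : δ₁ ≤ max δ₁ δ₂ := le_max_left _ _
  have hm₂ : δ₂ ≤ max δ₁ δ₂ := le_max_right _ _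
  by_cases hcase : μ.real (openConn v₂ b ∩ {ω | e ∈ ω}) ≤ μ.real (openConn v₁ b ∩ {ω | e ∈ ω})
  · -- use the second hypothesis
    linarith
  · -- `v₂` beats `v₁` on `{e open}`; by Lemma 5 it also beats `v₁` on `{e closed}`
    push Not at hcase
    have hopen₁ := goodStepEI_real_inter_open_eq w e (openConn v₁ b)
    have hopen₂ := goodStepEI_real_inter_open_eq w e (openConn v₂ b)
    have hclosed₁ := goodStepEI_real_inter_closed_eq w e (openConn v₁ b)
    have hclosed₂ := goodStepEI_real_inter_closed_eq w e (openConn v₂ b)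
    have hw0 : 0 ≤ (w e : ℝ) := (w e).2.1
    have hw1 : (w e : ℝ) ≤ 1 := (w e).2.2
    -- contracted comparison, strict
    have hcon : (prodBernoulli (Function.update w e 1)).real (openConn v₁ b) <
        (prodBernoulli (Function.update w e 1)).real (openConn v₂ b) := by
      by_contra hle
      push Not at hle
      have : μ.real (openConn v₂ b ∩ {ω | e ∈ ω}) ≤ μ.real (openConn v₁ b ∩ {ω | e ∈ ω}) := by
        rw [hopen₁, hopen₂]
        exact mul_le_mul_of_nonneg_left hle hw0
      exact absurd this (not_le.2 hcase)
    -- hence (contrapositive of Lemma 5) the deleted comparison is strict the same way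
    have hdel : (prodBernoulli (Function.update w e 0)).real (openConn v₁ b) <
        (prodBernoulli (Function.update w e 0)).real (openConn v₂ b) := by
      by_contra hle
      push Not at hle
      exact absurd (monotone_contract w v₂ v₁ u b hvu hle) (not_le.2 hcon)
    have hclosed : μ.real (openConn v₁ b ∩ {ω | e ∉ ω}) ≤ μ.real (openConn v₂ b ∩ {ω | e ∉ ω}) := by
      rw [hclosed₁, hclosed₂]
      exact mul_le_mul_of_nonneg_left hdel.le (by linarith)
    linarith

/-- **Two-edge sequential Lemma 3(i) ("first-open-edge domination").**  Non-loop pairs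
`e₁ = s(v₁,u₁)`, `e₂ = s(v₂,u₂)`; a vertex `a` with `μ(a ↔ b) ≤ μ(v_i ↔ b) + δ_i` (`δ₁ ≥ 0`).  Then
`μ(a ↔ b, e₁ ∨ e₂ open) ≤ μ(v₁ ↔ b, e₁ open) + μ(v₂ ↔ b, e₁ closed ∧ e₂ open) + max δ₁ δ₂`,
the left side being written as `μ(a ↔ b, e₁ open) + μ(a ↔ b, e₁ closed, e₂ open)`.
[cite: KozmaNitzan2024, Lemma 3(i) (pp. 6–7), Lemma 5 (p. 13); this work (memo HULLPORT-COUPLING.md §50(c))] -/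
theorem seq_two (w : Sym2 (Fin n) → unitInterval) (a v₁ u₁ v₂ u₂ b : Fin n) (h₁ne : v₁ ≠ u₁)
    (h₂ne : v₂ ≠ u₂) {δ₁ δ₂ : ℝ} (hδ₁ : 0 ≤ δ₁)
    (h₁ : (prodBernoulli w).real (openConn a b) ≤ (prodBernoulli w).real (openConn v₁ b) + δ₁)
    (h₂ : (prodBernoulli w).real (openConn a b) ≤ (prodBernoulli w).real (openConn v₂ b) + δ₂) :
    (prodBernoulli w).real (openConn a b ∩ {ω | s(v₁, u₁) ∈ ω}) +
        (prodBernoulli w).real (openConn a b ∩ {ω | s(v₁, u₁) ∉ ω} ∩ {ω | s(v₂, u₂) ∈ ω}) ≤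
      (prodBernoulli w).real (openConn v₁ b ∩ {ω | s(v₁, u₁) ∈ ω}) +
        (prodBernoulli w).real (openConn v₂ b ∩ {ω | s(v₁, u₁) ∉ ω} ∩ {ω | s(v₂, u₂) ∈ ω}) +
          max δ₁ δ₂ := by
  set μ := prodBernoulli w with hμ
  set e₁ : Sym2 (Fin n) := s(v₁, u₁) with he₁
  set e₂ : Sym2 (Fin n) := s(v₂, u₂) with he₂
  set w₀ : Sym2 (Fin n) → unitInterval := Function.update w e₁ 0 with hw₀
  set μ₀ := prodBernoulli w₀ with hμ₀
  have hm₁ : δ₁ ≤ max δ₁ δ₂ := le_max_left _ _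
  have hm₂ : δ₂ ≤ max δ₁ δ₂ := le_max_right _ _
  have hρ0 : 0 ≤ (w e₁ : ℝ) := (w e₁).2.1
  have hρ1 : (w e₁ : ℝ) ≤ 1 := (w e₁).2.2
  have hσ0 : 0 ≤ (w₀ e₂ : ℝ) := (w₀ e₂).2.1
  have hσ1 : (w₀ e₂ : ℝ) ≤ 1 := (w₀ e₂).2.2
  -- step 1: Lemma 3(i) for `e₁`
  have step1 := lemma3i_pair w a v₁ u₁ b h₁ne hδ₁ h₁
  rw [real_setOf_mem] at step1
  -- the slack of step 1
  set s₁ : ℝ := μ.real (openConn v₁ b ∩ {ω | e₁ ∈ ω}) - μ.real (openConn a b ∩ {ω | e₁ ∈ ω}) with hs₁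
  have hs₁lb : -(δ₁ * (w e₁ : ℝ)) ≤ s₁ := by rw [hs₁]; linarith
  -- closed-side identities
  have hcl_a : μ.real (openConn a b ∩ {ω | e₁ ∉ ω}) = (1 - (w e₁ : ℝ)) * μ₀.real (openConn a b) :=
    goodStepEI_real_inter_closed_eq w e₁ _
  have hcl_v₂ : μ.real (openConn v₂ b ∩ {ω | e₁ ∉ ω}) = (1 - (w e₁ : ℝ)) * μ₀.real (openConn v₂ b) :=
    goodStepEI_real_inter_closed_eq w e₁ _
  have hcl_a2 : μ.real (openConn a b ∩ {ω | e₁ ∉ ω} ∩ {ω | e₂ ∈ ω}) =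
      (1 - (w e₁ : ℝ)) * μ₀.real (openConn a b ∩ {ω | e₂ ∈ ω}) := by
    rw [Set.inter_assoc, Set.inter_comm {ω | e₁ ∉ ω}, ← Set.inter_assoc]
    exact goodStepEI_real_inter_closed_eq w e₁ _
  have hcl_v2 : μ.real (openConn v₂ b ∩ {ω | e₁ ∉ ω} ∩ {ω | e₂ ∈ ω}) =
      (1 - (w e₁ : ℝ)) * μ₀.real (openConn v₂ b ∩ {ω | e₂ ∈ ω}) := by
    rw [Set.inter_assoc, Set.inter_comm {ω | e₁ ∉ ω}, ← Set.inter_assoc]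
    exact goodStepEI_real_inter_closed_eq w e₁ _
  -- the switching lemma bounds the domination gap in `w₀`
  have hsw := switching w a v₁ u₁ v₂ b h₁ne h₁ h₂
  have hsplit_a := real_eq_inter_mem_add_inter_notMem w e₁ (openConn a b)
  -- `(1 - w e₁) * (μ₀(a) - μ₀(v₂)) ≤ s₁ + max δ₁ δ₂`
  have hgap : (1 - (w e₁ : ℝ)) * (μ₀.real (openConn a b) - μ₀.real (openConn v₂ b)) ≤ s₁ + max δ₁ δ₂ := by
    have : μ.real (openConn a b ∩ {ω | e₁ ∉ ω}) - μ.real (openConn v₂ b ∩ {ω | e₁ ∉ ω}) ≤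
        s₁ + max δ₁ δ₂ := by rw [hs₁]; linarith
    rw [hcl_a, hcl_v₂] at this
    linarith
  -- step 2: Lemma 3(i) for `e₂` in `w₀`, with slack `δ' = [μ₀(a) − μ₀(v₂)]⁺`
  set δ' : ℝ := max 0 (μ₀.real (openConn a b) - μ₀.real (openConn v₂ b)) with hδ'
  have hδ'0 : 0 ≤ δ' := le_max_left _ _
  have hδ'h : μ₀.real (openConn a b) ≤ μ₀.real (openConn v₂ b) + δ' := by
    have := le_max_right 0 (μ₀.real (openConn a b) - μ₀.real (openConn v₂ b))
    rw [← hδ'] at this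
    linarith
  have step2 := lemma3i_pair w₀ a v₂ u₂ b h₂ne hδ'0 hδ'h
  rw [real_setOf_mem] at step2
  -- `(1 - w e₁) * δ' ≤ s₁ + max δ₁ δ₂`
  have hgap' : (1 - (w e₁ : ℝ)) * δ' ≤ s₁ + max δ₁ δ₂ := by
    rcases le_total 0 (μ₀.real (openConn a b) - μ₀.real (openConn v₂ b)) with hpos | hneg
    · rw [hδ', max_eq_right hpos]
      exact hgap
    · rw [hδ', max_eq_left hneg, mul_zero]
      have : 0 ≤ δ₁ * (w e₁ : ℝ) := mul_nonneg hδ₁ hρ0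
      have : δ₁ * (w e₁ : ℝ) ≤ δ₁ := by nlinarith
      linarith
  -- assemble
  have hmain : μ.real (openConn a b ∩ {ω | e₁ ∉ ω} ∩ {ω | e₂ ∈ ω}) ≤
      μ.real (openConn v₂ b ∩ {ω | e₁ ∉ ω} ∩ {ω | e₂ ∈ ω}) + (s₁ + max δ₁ δ₂) * (w₀ e₂ : ℝ) := by
    rw [hcl_a2, hcl_v2]
    have h1' : (1 - (w e₁ : ℝ)) * μ₀.real (openConn a b ∩ {ω | e₂ ∈ ω}) ≤
        (1 - (w e₁ : ℝ)) * (μ₀.real (openConn v₂ b ∩ {ω | e₂ ∈ ω}) + δ' * (w₀ e₂ : ℝ)) :=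
      mul_le_mul_of_nonneg_left step2 (by linarith)
    have h2' : (1 - (w e₁ : ℝ)) * (δ' * (w₀ e₂ : ℝ)) ≤ (s₁ + max δ₁ δ₂) * (w₀ e₂ : ℝ) := by
      have := mul_le_mul_of_nonneg_right hgap' hσ0
      linarith [this]
    nlinarith [h1', h2']
  -- the error `(s₁ + max δ) * w₀ e₂ - s₁ ≤ max δ₁ δ₂`
  have hsmax : 0 ≤ s₁ + max δ₁ δ₂ := by
    have : 0 ≤ δ₁ * (w e₁ : ℝ) := mul_nonneg hδ₁ hρ0
    have : δ₁ * (w e₁ : ℝ) ≤ δ₁ := by nlinarith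
    linarith
  have herr : (s₁ + max δ₁ δ₂) * (w₀ e₂ : ℝ) - s₁ ≤ max δ₁ δ₂ := by
    have : (s₁ + max δ₁ δ₂) * (w₀ e₂ : ℝ) ≤ (s₁ + max δ₁ δ₂) * 1 :=
      mul_le_mul_of_nonneg_left hσ1 hsmax
    linarith
  rw [hs₁] at herr
  linarith [hmain, herr]

end SeqExchange

end

end Summit.CriticalPhenomena.PercolationContinuityZ3.Theorems
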